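import Summits.MatrixMultiplication.MatrixMultiplication.Theorems.OutsiderSandwichNoRefund
import HarnessLib

/-!
# Partial weights: the slice-transport obstruction at UNEQUAL formats

Route `OutsiderSandwich` (decomposition cell `decomp-mm`, lens 4 «minimal counterexample /
extremal reduction», gen 28, addendum), support for the aside leaf `BlockOneIsMM`
(stmt-MatrixMultiplication-27147).

The padding engine (`OutsiderSandwichNoPadding`, `…NoRefund`) needs equal output formats, because
it wants `diag(sgn)·Bᵀw ∈ range Cᵀ` for EVERY weight `w`.  At unequal formats this holds on a
SUBSPACE of weights, and that subspace is large when the formats are close: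

**Theorem** (`exists_partial_weights`).  If `⟨B⟩ ⊠ P^{⊠N'}` (`N' ≥ 1`) restricts to a tensor `t`
that is concise in slice form on both vector legs (input leg `κ'`, output leg `μ'`), then there are
a subspace `W ≤ ℂ^{κ'}` of weights and a linear map `Y : ℂ^{κ'} → ℂ^{μ'}` with
`|κ'| + |μ'| ≤ dim W + B·4^{N'}`, `Y` injective on `W`, and `S^t_w · Y(w) = 0` for every `w ∈ W`.
(`W = (diag(sgn)·Bᵀ)⁻¹(range Cᵀ)`, `Y = C^{-ᵀ}∘diag(sgn)∘Bᵀ` on `W`; the dimension bound is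
`dim(range Bᵀ ∩ range Cᵀ) ≥ |κ'| + |μ'| − |J|`.)

For `t = ⟨m⟩ ⊠ ⟨2,2,2⟩` and the source `⟨B⟩ ⊠ C₁` this gives `dim W ≥ 8m − 4B` with the slices
`Y ↦ (V₁Y₁, …, V_mY_m)`; the memo's core lemma (`dim W ≤ 2m` for any such annihilated pair) then
yields the level-one law `2·a(1,m) ≥ 3m` — that step is NOT in this file (it is pure linear
algebra of `2 × 2` matrices and lives in the sequel files).

## References
* D. Coppersmith, S. Winograd, *Matrix multiplication via arithmetic progressions*,
  J. Symbolic Comput. 9 (1990) 251–280, §7 (the coupled block). [CoppersmithWinograd1990]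
* P. Bürgisser, M. Clausen, M. A. Shokrollahi, *Algebraic Complexity Theory*, Springer (1997),
  §14.4 (restriction, conciseness, slices). [BurgisserClausenShokrollahi1997]
-/

noncomputable section
open scoped BigOperators Matrix
set_option linter.dupNamespace false
set_option autoImplicit false

namespace Summit.MatrixMultiplication.MatrixMultiplication.Theorems.OutsiderSandwichPartialWeights

open Literature.Computability.AlgebraicComplexity
open Summit.MatrixMultiplication.MatrixMultiplication.Theorems.OutsiderSandwichNoTightExchange
open Summit.MatrixMultiplication.MatrixMultiplication.Theorems.OutsiderSandwichSliceConcise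

section Transport

variable {ι' κ' μ' : Type} [Fintype ι'] [Fintype κ'] [Fintype μ']
variable {N' B : ℕ}

/-- **Partial weights.** A restriction `⟨B⟩ ⊠ P^{⊠N'} ⊵ t` (`N' ≥ 1`, `t` concise in slice form on
both vector legs) yields a subspace `W` of weights with `|κ'| + |μ'| ≤ dim W + |J|` and a linear
`Y`, injective on `W`, with `S^t_w · Y(w) = 0` for all `w ∈ W`.
[cite: CoppersmithWinograd1990, §7] -/
theorem exists_partial_weights (hN' : 1 ≤ N') {t : ι' → κ' → μ' → ℂ}
    (hY : ∀ w, slice t w = 0 → w = 0)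
    (hZ : ∀ ζ, (∀ w, (slice t w).mulVec ζ = 0) → ζ = 0)
    (h : TensorRestrictsTo (src N' B) t) :
    ∃ (W : Submodule ℂ (κ' → ℂ)) (Y : (κ' → ℂ) →ₗ[ℂ] (μ' → ℂ)),
      Fintype.card κ' + Fintype.card μ' ≤ Module.finrank ℂ W + Fintype.card (J N' B) ∧
      (∀ w ∈ W, Y w = 0 → w = 0) ∧
      (∀ w ∈ W, (slice t w).mulVec (Y w) = 0) := by
  classical
  obtain ⟨A, B', C, hABC⟩ := h
  set Bt : Matrix (J N' B) κ' ℂ := (Matrix.of B')ᵀ with hBt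
  set Ct : Matrix (J N' B) μ' ℂ := (Matrix.of C)ᵀ with hCt
  have hw : ∀ w' : κ' → ℂ, (fun b => ∑ b', w' b' * B' b' b) = Bt.mulVec w' := by
    intro w'; funext b
    simp only [hBt, Matrix.mulVec, dotProduct, Matrix.transpose_apply, Matrix.of_apply]
    exact Finset.sum_congr rfl fun b' _ => mul_comm _ _
  have key : ∀ w' : κ' → ℂ, slice t w' = Matrix.of A * slice (src N' B) (Bt.mulVec w') * Ct := by
    intro w'
    rw [← hw w']
    exact slice_restrict A B' C hABC w'
  have hCinj : ∀ ζ, Ct.mulVec ζ = 0 → ζ = 0 := by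
    intro ζ hζ
    refine hZ ζ fun w' => ?_
    rw [key w', ← Matrix.mulVec_mulVec, ← Matrix.mulVec_mulVec, hζ, Matrix.mulVec_zero,
      Matrix.mulVec_zero]
  have hBinj : ∀ w', Bt.mulVec w' = 0 → w' = 0 := by
    intro w' hw'
    refine hY w' ?_
    rw [key w', hw', slice_zero, Matrix.mul_zero, Matrix.zero_mul]
  set Sg : Matrix (J N' B) (J N' B) ℂ := Matrix.diagonal (sgn (m := B) hN') with hSg
  have hdiag : Sg * Sg = 1 := by
    rw [hSg, Matrix.diagonal_mul_diagonal, ← Matrix.diagonal_one]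
    congr 1; funext z; exact sgn_mul_self hN' z
  -- the two linear maps `f = diag(sgn)·Bᵀ`, `g = Cᵀ`
  let f : (κ' → ℂ) →ₗ[ℂ] (J N' B → ℂ) := Matrix.mulVecLin (Sg * Bt)
  let g : (μ' → ℂ) →ₗ[ℂ] (J N' B → ℂ) := Matrix.mulVecLin Ct
  have hf_apply : ∀ w, f w = Sg.mulVec (Bt.mulVec w) := fun w => by
    simp only [f, Matrix.mulVecLin_apply, Matrix.mulVec_mulVec]
  have hg_apply : ∀ ζ, g ζ = Ct.mulVec ζ := fun ζ => by simp only [g, Matrix.mulVecLin_apply]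
  have hfinj : Function.Injective f := by
    intro v v' hvv'
    have h0 : f (v - v') = 0 := by rw [map_sub, hvv', sub_self]
    rw [hf_apply] at h0
    have h1 : Bt.mulVec (v - v') = 0 := by
      have := congrArg Sg.mulVec h0
      rwa [Matrix.mulVec_mulVec, hdiag, Matrix.one_mulVec, Matrix.mulVec_zero] at this
    exact sub_eq_zero.mp (hBinj _ h1)
  have hginj : Function.Injective g := by
    intro v v' hvv'
    have h0 : g (v - v') = 0 := by rw [map_sub, hvv', sub_self]
    rw [hg_apply] at h0
    exact sub_eq_zero.mp (hCinj _ h0)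
  obtain ⟨E, hE⟩ := LinearMap.exists_leftInverse_of_injective g (LinearMap.ker_eq_bot.2 hginj)
  refine ⟨Submodule.comap f (LinearMap.range g), E.comp f, ?_, ?_, ?_⟩
  · -- dimension count
    have hmap : Submodule.map f (Submodule.comap f (LinearMap.range g)) =
        LinearMap.range f ⊓ LinearMap.range g := Submodule.map_comap_eq f _
    have h1 : Module.finrank ℂ (Submodule.comap f (LinearMap.range g)) =
        Module.finrank ℂ ↥(LinearMap.range f ⊓ LinearMap.range g) := by
      rw [← hmap]
      exact (Submodule.equivMapOfInjective f hfinj _).finrank_eq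
    have h2 := Submodule.finrank_sup_add_finrank_inf_eq (LinearMap.range f) (LinearMap.range g)
    have h3 : Module.finrank ℂ ↥(LinearMap.range f ⊔ LinearMap.range g) ≤
        Fintype.card (J N' B) := by
      have := Submodule.finrank_le (LinearMap.range f ⊔ LinearMap.range g)
      rwa [Module.finrank_fintype_fun_eq_card] at this
    have h4 : Module.finrank ℂ ↥(LinearMap.range f) = Fintype.card κ' := by
      rw [LinearMap.finrank_range_of_inj hfinj, Module.finrank_fintype_fun_eq_card]
    have h5 : Module.finrank ℂ ↥(LinearMap.range g) = Fintype.card μ' := by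
      rw [LinearMap.finrank_range_of_inj hginj, Module.finrank_fintype_fun_eq_card]
    omega
  · -- injectivity on `W`
    intro w hw h0
    obtain ⟨ζ₀, hζ₀⟩ := LinearMap.mem_range.1 (Submodule.mem_comap.1 hw)
    have hEw : (E.comp f) w = ζ₀ := by
      rw [LinearMap.comp_apply, ← hζ₀, ← LinearMap.comp_apply, hE, LinearMap.id_apply]
    rw [hEw] at h0
    rw [h0, map_zero] at hζ₀
    exact hfinj (by rw [← hζ₀, map_zero])
  · -- annihilation on `W`
    intro w hw
    obtain ⟨ζ₀, hζ₀⟩ := LinearMap.mem_range.1 (Submodule.mem_comap.1 hw)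
    have hEw : (E.comp f) w = ζ₀ := by
      rw [LinearMap.comp_apply, ← hζ₀, ← LinearMap.comp_apply, hE, LinearMap.id_apply]
    have hCt : Ct.mulVec ζ₀ = fun z => sgn hN' z * Bt.mulVec w z := by
      rw [← hg_apply, hζ₀, hf_apply]
      funext z; rw [hSg]; exact Matrix.mulVec_diagonal _ _ z
    rw [hEw, key w, ← Matrix.mulVec_mulVec, ← Matrix.mulVec_mulVec, hCt, slice_mulVec_sgn hN',
      Matrix.mulVec_zero]

end Transport

end Summit.MatrixMultiplication.MatrixMultiplication.Theorems.OutsiderSandwichPartialWeights
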